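import Summits.HodgeConjecture.HodgeConjecture.Theorems.R90S3KrasnerTransportToCompletion   -- ★ P2″ (K2E4-p14): `isInducing_algHom_padicAlgCl`, `exists_radius_transport_sq_class`
import Literature.NumberTheory.LocalFields.KrasnerLocallyConstant                          -- ★ Krasner local constancy: `exists_root_near_of_coeff_near'`, `root_near_unique`, `adjoin_eq_adjoin_of_coeff_near`, `norm_root_le_one`
import Mathlib.NumberTheory.Padics.RingHoms
import Mathlib.Analysis.SpecificLimits.Normed
import HarnessLib

/-!
# R90-TF · S3, (U3-F) assembly, layer B6: ROOTS OF THE PLANTED POLYNOMIAL NEAR THE `p`-ADIC TARGETS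
# (`Theorems/R90S3PlantedRootsNear.lean`; captain's skeleton `R90/S3/SKELETON-P8-AuxGlobaliseField.K2E3-p17-g11.md` 941dd0e5 §B6 (+ §B3 radii, absorbed);
# dealer R90-C12-plan (g2) 01:04:01Z ∕ 01:16:20Z «B6+B7 glue … cut it B6 file first»)

Cell `hodgecm-mathlib`, crux H413 (`stmt-HodgeConjecture-24833`), route of record `HCCMUnconditional`; programme R90-TF, section S3 (base `R90-C12`), the (U3-F)
residual `stub_R90_S3_auxGlobaliseField` (ℚ-planted road).  Lane `--supports stmt-HodgeConjecture-24833 --as helper`; THEOREMS ONLY (no `def`, no `instance`, no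
notation, no named fact, no `sorry`); ★∕Mathlib imports only; ns `…R90.S3`.

THE MATHEMATICS [Gouvêa, *p-adic Numbers*, Cor. 6.8.3 of Krasner's lemma; Neukirch II (8.2)–(8.4)].  At `K := L_w` (continuous finite `ℚ_p`-structure,
`ι : K →ₐ[ℚ_p] Q̄_p`) the local planting datum (★ B2 `exists_localPlantingDatum`) is a non-zero generator `y` with `‖ι y‖ < 1` and a monic `H₀ ∈ ℤ_p[X]`, separable
over `ℚ_p`, with roots `ι y` and DISTINCT units `c₁ … c_r ∈ ℤ_p^×`; the planted `g ∈ ℤ[X]` (★ B4a `exists_planted_of_targets`) is monic of the same degree with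
`g ≡ H₀ (mod p^N)`.  Then, for `N` large (depending only on the local datum and a prescribed closeness `ρ > 0`):
* §1 CURRENCY BRIDGES: `g ≡ H₀ (mod p^N)` ⟹ `‖(H₀)ᵢ − gᵢ‖_p ≤ p^{−N}` (`PadicInt.ker_toZModPow`); `v_w(β) < 1 ⟺ ‖ι β‖ < 1` (`βⁿ → 0` read through the inducing
  `ι`, ★ P2″ §1); a root of a monic polynomial whose lower coefficients have norm `< 1` has norm `< 1` (discharges `‖ι y‖ < 1` from ★ B2's `h₀`);
* §2 CORE IN `Q̄_p` (**`exists_tolerance_root_matching`**, radii of skeleton §B3 absorbed): for `f ∈ ℚ_p[X]` monic separable with unit-ball coefficients and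
  `ρ > 0` there is `ε > 0` such that every monic `g` of the same degree with `‖fᵢ − gᵢ‖ ≤ ε` carries an INJECTIVE matching `a ↦ φ a` from the roots of `f` to
  roots of `g` with `‖a − φ a‖ < ρ` and `ℚ_p⟮φ a⟯ = ℚ_p⟮a⟯` (★ `exists_root_near_of_coeff_near′` + `root_near_unique` + `adjoin_eq_adjoin_of_coeff_near`, with
  `δ := min(root separation, ρ, 1)`, `ε := δⁿ∕2`);
* §3 HEAD (**`exists_pow_planted_roots_near`**): `β, s ∈ K` with `g(β) = 0`, `ℚ_p⟮β⟯ = ⊤`, `β = y·s²`, `v_w(β) < 1`, `‖ι β − ι y‖ < ρ` (★ P2″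
  `exists_radius_transport_sq_class` on the matched root `φ(ι y)`), and distinct units `c′ᵢ ∈ ℤ_p^×` with `g(c′ᵢ) = 0`, `‖c′ᵢ − cᵢ‖ < ρ` (the matched roots
  `φ(cᵢ)` generate `ℚ_p⟮cᵢ⟯ = ⊥`, so lie in `ℚ_p`) — exactly the inputs of layer B7 (embeddings `F′ := ℚ[X]∕(g) → K`, `→ ℚ_p` and their places).
HONEST LABEL: B6 is a sub-brick of the GENUINE residual (U3-F) and closes nothing alone; HC_CM is proved only modulo the 7 printed citations (2 remaining named
inputs: hLiu418 = stmt-HodgeConjecture-24832, h413 = stmt-HodgeConjecture-24833) until rung 0 closes; count-neutral helper.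

## References
* [Gouvea1993PadicNumbers] F. Q. Gouvêa, *p-adic Numbers*, Universitext (1993), Thm. 6.8.2 (Krasner), Cor. 6.8.3.
* [NeukirchANT1999] J. Neukirch, *Algebraic Number Theory*, Grundlehren 322 (1999), Ch. II (8.2)–(8.4).
* [Serre1979] J.-P. Serre, *Local Fields*, GTM 67 (1979), Ch. II §5.
-/

set_option autoImplicit false
-- the mandated namespace repeats the single-problem summit's segment (`HodgeConjecture.HodgeConjecture`)
set_option linter.dupNamespace false

noncomputable section

open Polynomial IntermediateField Topology Filter IsDedekindDomain NumberField
open Literature.NumberTheory.LocalFields (norm_root_le_one norm_sub_eq_of_lt_of_le exists_root_near_of_coeff_near' root_near_unique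
  adjoin_eq_adjoin_of_coeff_near)

namespace Summit.HodgeConjecture.HodgeConjecture.R90.S3

variable (p : ℕ) [Fact p.Prime]

/-! ## §1 Currency bridges -/

/-- **`g ≡ H₀ (mod p^N)` coefficientwise ⟹ `‖(H₀)ᵢ − gᵢ‖_p ≤ p^{−N}`** (★ B4a's congruence currency → the norm currency of Krasner's lemma; Mathlib
`PadicInt.ker_toZModPow`, `PadicInt.norm_le_pow_iff_mem_span_pow`). [cite: Gouvea1993PadicNumbers, Cor. 6.8.3] -/
theorem norm_sub_le_of_map_eq_map_toZModPow {H₀ : ℤ_[p][X]} {g : ℤ[X]} {N : ℕ}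
    (h : g.map (Int.castRingHom (ZMod (p ^ N))) = H₀.map (PadicInt.toZModPow N)) (i : ℕ) :
    ‖((H₀.coeff i : ℤ_[p]) : ℚ_[p]) - ((g.coeff i : ℤ) : ℚ_[p])‖ ≤ (p : ℝ) ^ (-(N : ℤ)) := by
  have hx : H₀.coeff i - (g.coeff i : ℤ_[p]) ∈ RingHom.ker (PadicInt.toZModPow N : ℤ_[p] →+* ZMod (p ^ N)) := by
    rw [RingHom.mem_ker, map_sub, map_intCast, sub_eq_zero]
    have hi := congrArg (fun q => Polynomial.coeff q i) h
    simp only [coeff_map, eq_intCast] at hi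
    exact hi.symm
  rw [PadicInt.ker_toZModPow] at hx
  have hle := (PadicInt.norm_le_pow_iff_mem_span_pow _ N).2 hx
  rwa [PadicInt.norm_def, PadicInt.coe_sub, PadicInt.coe_intCast] at hle

/-- `p^{−N} → 0`: for `ε > 0` some `p^{−N} < ε`. [folklore] -/
theorem exists_zpow_neg_lt {ε : ℝ} (hε : 0 < ε) : ∃ N : ℕ, (p : ℝ) ^ (-(N : ℤ)) < ε := by
  have hp1 : (1 : ℝ) < p := by exact_mod_cast (Fact.out : p.Prime).one_lt
  obtain ⟨N, hN⟩ := exists_pow_lt_of_lt_one hε (inv_lt_one_of_one_lt₀ hp1)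
  exact ⟨N, by rwa [zpow_neg, zpow_natCast, ← inv_pow]⟩

/-- `p^{−N′} ≤ p^{−N}` for `N ≤ N′`. [folklore] -/
theorem zpow_neg_le_zpow_neg {N N' : ℕ} (h : N ≤ N') : (p : ℝ) ^ (-(N' : ℤ)) ≤ (p : ℝ) ^ (-(N : ℤ)) := by
  have hp1 : (1 : ℝ) ≤ p := by exact_mod_cast (Fact.out : p.Prime).one_lt.le
  exact zpow_le_zpow_right₀ hp1 (by omega)

/-- **A root of a monic polynomial whose lower coefficients have norm `< 1` has norm `< 1`** (in any ultrametric normed field extension: `z^d = −Σ_{i<d} aᵢ zⁱ`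
and, if `‖z‖ ≥ 1`, the right-hand side has norm `< ‖z‖^d`).  Discharges `‖ι y‖ < 1` from ★ B2's `h₀`. [cite: NeukirchANT1999, Ch. II (8.2)-(8.4)] -/
theorem norm_lt_one_of_aeval_eq_zero {A : Type*} [NormedField A] [IsUltrametricDist A] [NormedAlgebra ℚ_[p] A]
    {h : ℚ_[p][X]} (hm : h.Monic) (hd : h.natDegree ≠ 0) (hlow : ∀ i, i < h.natDegree → ‖h.coeff i‖ < 1) {z : A}
    (hz : aeval z h = 0) : ‖z‖ < 1 := by
  by_contra hz1
  rw [not_lt] at hz1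
  -- `z^d = -Σ_{i<d} aᵢ zⁱ`
  have hsum : aeval z h = (∑ i ∈ Finset.range h.natDegree, algebraMap ℚ_[p] A (h.coeff i) * z ^ i) + z ^ h.natDegree := by
    rw [aeval_eq_sum_range, Finset.sum_range_succ, hm.coeff_natDegree, one_smul]
    simp only [Algebra.smul_def]
  have hzd : z ^ h.natDegree = -∑ i ∈ Finset.range h.natDegree, algebraMap ℚ_[p] A (h.coeff i) * z ^ i :=
    eq_neg_of_add_eq_zero_right (hsum.symm.trans hz)
  have hne : (Finset.range h.natDegree).Nonempty := Finset.nonempty_range_iff.2 hd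
  obtain ⟨i, hi, hle⟩ := IsUltrametricDist.exists_norm_finsetSum_le_of_nonempty hne (fun i => algebraMap ℚ_[p] A (h.coeff i) * z ^ i)
  rw [Finset.mem_range] at hi
  have key : ‖z‖ ^ h.natDegree < ‖z‖ ^ h.natDegree :=
    calc ‖z‖ ^ h.natDegree = ‖z ^ h.natDegree‖ := (norm_pow z _).symm
      _ = ‖∑ i ∈ Finset.range h.natDegree, algebraMap ℚ_[p] A (h.coeff i) * z ^ i‖ := by rw [hzd, norm_neg]
      _ ≤ ‖algebraMap ℚ_[p] A (h.coeff i) * z ^ i‖ := hle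
      _ = ‖h.coeff i‖ * ‖z‖ ^ i := by rw [norm_mul, norm_pow, norm_algebraMap']
      _ < 1 * ‖z‖ ^ i := by gcongr; exact hlow i hi
      _ = ‖z‖ ^ i := one_mul _
      _ ≤ ‖z‖ ^ h.natDegree := pow_le_pow_right₀ hz1 hi.le
  exact lt_irrefl _ key

/-! ## §2 The core in `Q̄_p`: a tolerance for coefficient perturbations, with an injective root matching -/

/-- **Separation of a finite set**: some `δ > 0` is `≤ ‖a − a′‖` for all distinct `a, a′` in `s`. [folklore] -/
theorem exists_separation {A : Type*} [NormedAddCommGroup A] (s : Finset A) :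
    ∃ δ : ℝ, 0 < δ ∧ ∀ a ∈ s, ∀ a' ∈ s, a ≠ a' → δ ≤ ‖a - a'‖ := by
  classical
  set P : Finset (A × A) := (s ×ˢ s).filter (fun q => q.1 ≠ q.2) with hP
  by_cases hPe : P.Nonempty
  · obtain ⟨q, hq, hmin⟩ := P.exists_min_image (fun q : A × A => ‖q.1 - q.2‖) hPe
    have hq' : q.1 ≠ q.2 := (Finset.mem_filter.1 hq).2
    exact ⟨‖q.1 - q.2‖, norm_pos_iff.2 (sub_ne_zero.2 hq'),
      fun a ha a' ha' hne => hmin (a, a') (Finset.mem_filter.2 ⟨Finset.mk_mem_product ha ha', hne⟩)⟩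
  · refine ⟨1, one_pos, fun a ha a' ha' hne => ?_⟩
    exact absurd ⟨(a, a'), Finset.mem_filter.2 ⟨Finset.mk_mem_product ha ha', hne⟩⟩ hPe

/-- **THE CORE: A TOLERANCE WITH AN INJECTIVE ROOT MATCHING** (Gouvêa Cor. 6.8.3, both halves, radii absorbed).  Let `f ∈ ℚ_p[X]` be monic, separable, of degree
`n ≥ 1`, with coefficients in the closed unit ball, and `ρ > 0`.  There is `ε > 0` such that for every monic `g ∈ ℚ_p[X]` of degree `n` with `‖fᵢ − gᵢ‖ ≤ ε` for all
`i` there is a map `φ` sending each root `a ∈ Q̄_p` of `f` to a root `φ a` of `g` with `‖a − φ a‖ < ρ` and `ℚ_p⟮φ a⟯ = ℚ_p⟮a⟯`, injective on the roots of `f`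
(`δ := min(root separation of f, ρ, 1)`, `ε := δⁿ∕2`; ★ `exists_root_near_of_coeff_near′`, `root_near_unique`, `adjoin_eq_adjoin_of_coeff_near`).
[cite: Gouvea1993PadicNumbers, Cor. 6.8.3] -/
theorem exists_tolerance_root_matching (f : ℚ_[p][X]) (hfm : f.Monic) (hfsep : f.Separable) (hf1 : ∀ i, ‖f.coeff i‖ ≤ 1)
    (hn : f.natDegree ≠ 0) {ρ : ℝ} (hρ : 0 < ρ) :
    ∃ ε : ℝ, 0 < ε ∧ ∀ g : ℚ_[p][X], g.Monic → g.natDegree = f.natDegree → (∀ i, ‖f.coeff i - g.coeff i‖ ≤ ε) →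
      ∃ φ : PadicAlgCl p → PadicAlgCl p,
        (∀ a ∈ f.aroots (PadicAlgCl p), φ a ∈ g.aroots (PadicAlgCl p) ∧ ‖a - φ a‖ < ρ ∧ ℚ_[p]⟮φ a⟯ = ℚ_[p]⟮a⟯) ∧
        (∀ a ∈ f.aroots (PadicAlgCl p), ∀ a' ∈ f.aroots (PadicAlgCl p), φ a = φ a' → a = a') := by
  classical
  -- separation of the roots of `F := f ⊗ Q̄_p`
  obtain ⟨δ₀, hδ₀, hsep₀⟩ := exists_separation (f.aroots (PadicAlgCl p)).toFinset
  -- the radius and the tolerance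
  set δ : ℝ := min δ₀ (min ρ 1) with hδ
  have hδpos : 0 < δ := lt_min hδ₀ (lt_min hρ one_pos)
  have hδρ : δ ≤ ρ := (min_le_right _ _).trans (min_le_left _ _)
  have hδ1 : δ ≤ 1 := (min_le_right _ _).trans (min_le_right _ _)
  have hsep : ∀ a ∈ f.aroots (PadicAlgCl p), ∀ a' ∈ f.aroots (PadicAlgCl p), a ≠ a' → δ ≤ ‖a - a'‖ := fun a ha a' ha' hne =>
    (min_le_left _ _).trans (hsep₀ a (Multiset.mem_toFinset.2 ha) a' (Multiset.mem_toFinset.2 ha') hne)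
  have hεpos : 0 < δ ^ f.natDegree / 2 := by positivity
  have hεlt : δ ^ f.natDegree / 2 < δ ^ f.natDegree := half_lt_self (by positivity)
  have hε1 : δ ^ f.natDegree / 2 < 1 := hεlt.trans_le (pow_le_one₀ hδpos.le hδ1)
  refine ⟨δ ^ f.natDegree / 2, hεpos, fun g hgm hdeg hclose => ?_⟩
  -- the data of ★ Krasner for `F := f ⊗ Q̄_p`, `G := g ⊗ Q̄_p`
  have hFm : (f.map (algebraMap ℚ_[p] (PadicAlgCl p))).Monic := hfm.map _
  have hGm : (g.map (algebraMap ℚ_[p] (PadicAlgCl p))).Monic := hgm.map _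
  have hFs : (f.map (algebraMap ℚ_[p] (PadicAlgCl p))).Splits := IsAlgClosed.splits _
  have hGs : (g.map (algebraMap ℚ_[p] (PadicAlgCl p))).Splits := IsAlgClosed.splits _
  have hdegF : (f.map (algebraMap ℚ_[p] (PadicAlgCl p))).natDegree = f.natDegree := hfm.natDegree_map _
  have hdegG : (g.map (algebraMap ℚ_[p] (PadicAlgCl p))).natDegree = (f.map (algebraMap ℚ_[p] (PadicAlgCl p))).natDegree := by
    rw [hgm.natDegree_map, hdegF, hdeg]
  have hnF : (f.map (algebraMap ℚ_[p] (PadicAlgCl p))).natDegree ≠ 0 := by rwa [hdegF]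
  have hcoeffΩ : ∀ i, ‖algebraMap ℚ_[p] (PadicAlgCl p) (f.coeff i) - algebraMap ℚ_[p] (PadicAlgCl p) (g.coeff i)‖ ≤ δ ^ f.natDegree / 2 :=
    fun i => by rw [← map_sub, norm_algebraMap']; exact hclose i
  have hcoeff : ∀ i, ‖(f.map (algebraMap ℚ_[p] (PadicAlgCl p))).coeff i - (g.map (algebraMap ℚ_[p] (PadicAlgCl p))).coeff i‖ ≤ δ ^ f.natDegree / 2 :=
    fun i => by rw [coeff_map, coeff_map]; exact hcoeffΩ i
  have hεδF : δ ^ f.natDegree / 2 < δ ^ (f.map (algebraMap ℚ_[p] (PadicAlgCl p))).natDegree := by rwa [hdegF]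
  -- the coefficients of `g` are in the unit ball too, hence so are all roots
  have hg1 : ∀ i, ‖g.coeff i‖ ≤ 1 := fun i =>
    calc ‖g.coeff i‖ = ‖-(f.coeff i - g.coeff i) + f.coeff i‖ := by rw [neg_sub, sub_add_cancel]
      _ ≤ max ‖-(f.coeff i - g.coeff i)‖ ‖f.coeff i‖ := IsUltrametricDist.norm_add_le_max _ _
      _ ≤ 1 := max_le (by rw [norm_neg]; exact (hclose i).trans hε1.le) (hf1 i)
  have hFr : ∀ a ∈ f.aroots (PadicAlgCl p), ‖a‖ ≤ 1 := fun a ha =>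
    norm_root_le_one hFm (fun i => by rw [coeff_map, norm_algebraMap']; exact hf1 i) ((mem_roots hFm.ne_zero).1 ha).eq_zero
  have hGr : ∀ b ∈ g.aroots (PadicAlgCl p), ‖b‖ ≤ 1 := fun b hb =>
    norm_root_le_one hGm (fun i => by rw [coeff_map, norm_algebraMap']; exact hg1 i) ((mem_roots hGm.ne_zero).1 hb).eq_zero
  -- the matching (root continuity, Gouvêa Problem 282)
  have hmatch : ∀ a ∈ f.aroots (PadicAlgCl p), ∃ b ∈ g.aroots (PadicAlgCl p), ‖a - b‖ < δ := fun a ha =>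
    exists_root_near_of_coeff_near' hGm hGs hdegG hnF hδpos hεpos.le hεδF hcoeff ha (hFr a ha)
  choose! φ hφG hφlt using hmatch
  refine ⟨φ, fun a ha => ⟨hφG a ha, (hφlt a ha).trans_le hδρ, ?_⟩, fun a ha a' ha' heq => ?_⟩
  · -- Krasner in both directions
    exact adjoin_eq_adjoin_of_coeff_near hfm hgm hFs hGs hdeg hn hfsep hsep hδpos hεpos.le hεlt hcoeffΩ hFr hGr (hφG a ha) ha
      (by rw [norm_sub_rev]; exact hφlt a ha)
  · -- injectivity: two roots of `f` within `< δ` of the same point coincide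
    refine root_near_unique hsep ha ha' (b := φ a) (by rw [norm_sub_rev]; exact hφlt a ha) ?_
    rw [heq, norm_sub_rev]
    exact hφlt a' ha'

/-! ## §3 HEAD: at `K = L_w`, roots of the planted polynomial in `K` (square class of `y`) and in `ℤ_p^×` (near the `cᵢ`) -/

section Head

variable {L : Type} [Field L] [NumberField L] (w : HeightOneSpectrum (𝓞 L))
  [Algebra ℚ_[p] (w.adicCompletion L)] [FiniteDimensional ℚ_[p] (w.adicCompletion L)]

/-- **`v_w(β) < 1 ⟺ ‖ι β‖ < 1`** at `K = L_w` with a continuous finite `ℚ_p`-structure and `ι : K →ₐ[ℚ_p] Q̄_p` (both say `βⁿ → 0`, and `ι` induces the topology,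
★ P2″ `isInducing_algHom_padicAlgCl`). [cite: Serre1979, Ch. II §5] -/
theorem valued_lt_one_iff_norm_lt_one (hc : Continuous (algebraMap ℚ_[p] (w.adicCompletion L)))
    (ι : w.adicCompletion L →ₐ[ℚ_[p]] PadicAlgCl p) (β : w.adicCompletion L) : Valued.v β < 1 ↔ ‖ι β‖ < 1 := by
  rw [← Valued.toNormedField.norm_lt_one_iff, ← tendsto_pow_atTop_nhds_zero_iff_norm_lt_one,
    ← tendsto_pow_atTop_nhds_zero_iff_norm_lt_one, (isInducing_algHom_padicAlgCl p hc ι).tendsto_nhds_iff]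
  simp only [Function.comp_def, map_pow, map_zero]

/-- **B6 HEAD — ROOTS OF THE PLANTED POLYNOMIAL NEAR THE `p`-ADIC TARGETS.**  At `K = L_w` (continuous finite `ℚ_p`-structure, `ι : K →ₐ[ℚ_p] Q̄_p`) let
`y ≠ 0` generate `K` with `‖ι y‖ < 1`; let `H₀ ∈ ℤ_p[X]` be monic, separable over `ℚ_p`, with `H₀(y) = 0` and distinct unit roots `cᵢ ∈ ℤ_p^×` (`i < r`); let
`ρ > 0`.  Then there is `N` such that for every `N′ ≥ N` and every monic `g ∈ ℤ[X]` of the same degree with `g ≡ H₀ (mod p^{N′})` coefficientwise: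
`g` has a root `β ∈ K` with `ℚ_p⟮β⟯ = ⊤`, `β = y·s²`, `v_w(β) < 1`, `‖ι β − ι y‖ < ρ`, and `r` DISTINCT unit roots `c′ᵢ ∈ ℤ_p^×` with `‖c′ᵢ − cᵢ‖ < ρ`
(§2 at `f := H₀ ⊗ ℚ_p`, radius `min(ρ, r_y, 1)` with `r_y` from ★ P2″ `exists_radius_transport_sq_class`; the matched roots of the `cᵢ` generate `⊥`, hence
are `ℚ_p`-rational).  These are the inputs of layer B7. [cite: Gouvea1993PadicNumbers, Cor. 6.8.3] [cite: NeukirchANT1999, Ch. II (8.2)-(8.4)] -/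
theorem exists_pow_planted_roots_near (hc : Continuous (algebraMap ℚ_[p] (w.adicCompletion L)))
    (ι : w.adicCompletion L →ₐ[ℚ_[p]] PadicAlgCl p) {y : w.adicCompletion L} (hy0 : y ≠ 0) (hy : ℚ_[p]⟮y⟯ = ⊤) (hy1 : ‖ι y‖ < 1)
    (H₀ : ℤ_[p][X]) (hHm : H₀.Monic) (hHsep : (H₀.map (algebraMap ℤ_[p] ℚ_[p])).Separable)
    (hHy : aeval y (H₀.map (algebraMap ℤ_[p] ℚ_[p])) = 0)
    {r : ℕ} (c : Fin r → ℤ_[p]) (hcu : ∀ i, IsUnit (c i)) (hci : Function.Injective c) (hHc : ∀ i, H₀.IsRoot (c i))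
    {ρ : ℝ} (hρ : 0 < ρ) :
    ∃ N : ℕ, ∀ N' : ℕ, N ≤ N' → ∀ g : ℤ[X], g.Monic → g.natDegree = H₀.natDegree →
      g.map (Int.castRingHom (ZMod (p ^ N'))) = H₀.map (PadicInt.toZModPow N') →
      ∃ (β s : w.adicCompletion L) (c' : Fin r → ℤ_[p]),
        aeval β g = 0 ∧ ℚ_[p]⟮β⟯ = ⊤ ∧ β = y * s ^ 2 ∧ Valued.v β < 1 ∧ ‖ι β - ι y‖ < ρ ∧
        Function.Injective c' ∧ ∀ i, IsUnit (c' i) ∧ aeval ((c' i : ℤ_[p]) : ℚ_[p]) g = 0 ∧ ‖((c' i : ℤ_[p]) : ℚ_[p]) - c i‖ < ρ := by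
  -- `f := H₀ ⊗ ℚ_p`
  set f : ℚ_[p][X] := H₀.map (algebraMap ℤ_[p] ℚ_[p]) with hf
  have hfm : f.Monic := hHm.map _
  have hfdeg : f.natDegree = H₀.natDegree := hHm.natDegree_map _
  have hf1 : ∀ i, ‖f.coeff i‖ ≤ 1 := fun i => by
    rw [hf, coeff_map, PadicInt.algebraMap_apply, PadicInt.padic_norm_e_of_padicInt]; exact PadicInt.norm_le_one _
  have hn : f.natDegree ≠ 0 := by
    intro h0
    rw [eq_one_of_monic_natDegree_zero hfm h0, map_one] at hHy
    exact one_ne_zero hHy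
  -- the radius of the square-class transport (★ P2″) and the tolerance of §2
  obtain ⟨r₀, hr₀, htrans⟩ := exists_radius_transport_sq_class p w hc ι hy0 hy
  have hρ' : 0 < min ρ (min r₀ 1) := lt_min hρ (lt_min hr₀ one_pos)
  obtain ⟨ε, hε, hcore⟩ := exists_tolerance_root_matching p f hfm hHsep hf1 hn hρ'
  obtain ⟨N, hN⟩ := exists_zpow_neg_lt p hε
  refine ⟨N, fun N' hNN' g hgm hgdeg hcong => ?_⟩
  -- `g' := g ⊗ ℚ_p` is `ε`-close to `f`
  set g' : ℚ_[p][X] := g.map (Int.castRingHom ℚ_[p]) with hg'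
  have hg'm : g'.Monic := hgm.map _
  have hg'deg : g'.natDegree = f.natDegree := by rw [hgm.natDegree_map, hgdeg, hfdeg]
  have hclose : ∀ i, ‖f.coeff i - g'.coeff i‖ ≤ ε := fun i => by
    rw [hf, hg', coeff_map, coeff_map, PadicInt.algebraMap_apply, eq_intCast]
    exact ((norm_sub_le_of_map_eq_map_toZModPow p hcong i).trans (zpow_neg_le_zpow_neg p hNN')).trans hN.le
  obtain ⟨φ, hφ, hφinj⟩ := hcore g' hg'm hg'deg hclose
  -- reading roots of `g'` as roots of `g`
  have hg'K : ∀ β : w.adicCompletion L, aeval β g = aeval β g' := fun β => by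
    rw [aeval_def, aeval_def, hg', eval₂_map, RingHom.ext_int (algebraMap ℤ (w.adicCompletion L)) ((algebraMap ℚ_[p] _).comp (Int.castRingHom ℚ_[p]))]
  have hg'Q : ∀ x : ℚ_[p], aeval x g = eval x g' := fun x => by rw [aeval_def, algebraMap_int_eq, hg', eval_map]
  -- (i) the root matched with `ι y`
  have hyF : ι y ∈ f.aroots (PadicAlgCl p) := by
    rw [mem_aroots]; exact ⟨hfm.ne_zero, by rw [aeval_algHom_apply, hHy, map_zero]⟩
  obtain ⟨hbG, hblt, hbadj⟩ := hφ (ι y) hyF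
  have hblt' : ‖φ (ι y) - ι y‖ < min ρ (min r₀ 1) := by rw [norm_sub_rev]; exact hblt
  obtain ⟨β, s, hιβ, hβtop, hβys⟩ := htrans (φ (ι y)) ((hblt'.trans_le (min_le_right _ _)).trans_le (min_le_left _ _)) hbadj
  have hβroot : aeval β g = 0 := by
    rw [hg'K]
    have h1 : ι (aeval β g') = 0 := by rw [← aeval_algHom_apply, hιβ]; exact (mem_aroots.1 hbG).2
    exact (map_eq_zero_iff ι ι.toRingHom.injective).1 h1
  have hβ1 : ‖ι β‖ < 1 := by
    rw [hιβ]
    calc ‖φ (ι y)‖ = ‖(φ (ι y) - ι y) + ι y‖ := by rw [sub_add_cancel]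
      _ ≤ max ‖φ (ι y) - ι y‖ ‖ι y‖ := IsUltrametricDist.norm_add_le_max _ _
      _ < 1 := max_lt ((hblt'.trans_le (min_le_right _ _)).trans_le (min_le_right _ _)) hy1
  -- (ii) the roots matched with the `cᵢ`: they generate `⊥`, so they are `ℚ_p`-rational
  have hcroot : ∀ i, eval ((c i : ℤ_[p]) : ℚ_[p]) f = 0 := fun i => by
    rw [hf, eval_map, ← PadicInt.algebraMap_apply, eval₂_hom, (hHc i).eq_zero, map_zero]
  have hcF : ∀ i, algebraMap ℚ_[p] (PadicAlgCl p) (c i : ℚ_[p]) ∈ f.aroots (PadicAlgCl p) := fun i =>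
    mem_aroots.2 ⟨hfm.ne_zero, by rw [aeval_algebraMap_apply_eq_algebraMap_eval, hcroot i, map_zero]⟩
  have hrat : ∀ i, ∃ c'' : ℚ_[p], algebraMap ℚ_[p] (PadicAlgCl p) c'' = φ (algebraMap ℚ_[p] (PadicAlgCl p) (c i : ℚ_[p])) := fun i => by
    obtain ⟨-, -, hadj⟩ := hφ _ (hcF i)
    have hbot : ℚ_[p]⟮algebraMap ℚ_[p] (PadicAlgCl p) (c i : ℚ_[p])⟯ = ⊥ := adjoin_simple_eq_bot_iff.2 (IntermediateField.algebraMap_mem ⊥ _)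
    rw [hbot, adjoin_simple_eq_bot_iff, IntermediateField.mem_bot] at hadj
    exact hadj
  choose c'' hc'' using hrat
  have hcu1 : ∀ i, ‖((c i : ℤ_[p]) : ℚ_[p])‖ = 1 := fun i => by rw [PadicInt.padic_norm_e_of_padicInt]; exact PadicInt.isUnit_iff.1 (hcu i)
  have hclose'' : ∀ i, ‖c'' i - c i‖ < min ρ (min r₀ 1) := fun i => by
    rw [← norm_algebraMap' (PadicAlgCl p), map_sub, hc'', norm_sub_rev]
    exact (hφ _ (hcF i)).2.1
  have hnorm'' : ∀ i, ‖c'' i‖ = 1 := fun i => by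
    have h := norm_sub_eq_of_lt_of_le (a' := (0 : ℚ_[p])) ((hclose'' i).trans_le ((min_le_right _ _).trans (min_le_right _ _)))
      (by rw [sub_zero, hcu1 i])
    rwa [sub_zero, sub_zero, hcu1 i] at h
  refine ⟨β, s, fun i => ⟨c'' i, (hnorm'' i).le⟩, hβroot, hβtop, hβys, (valued_lt_one_iff_norm_lt_one p w hc ι β).2 hβ1,
    by rw [hιβ]; exact (hblt'.trans_le (min_le_left _ _)), fun i j hij => ?_, fun i => ⟨PadicInt.isUnit_iff.2 (hnorm'' i), ?_, ?_⟩⟩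
  · -- injectivity of `c′`
    have h1 : c'' i = c'' j := congrArg (fun z : ℤ_[p] => (z : ℚ_[p])) hij
    have h2 : φ (algebraMap ℚ_[p] (PadicAlgCl p) (c i : ℚ_[p])) = φ (algebraMap ℚ_[p] (PadicAlgCl p) (c j : ℚ_[p])) := by
      rw [← hc'', ← hc'', h1]
    have h3 := hφinj _ (hcF i) _ (hcF j) h2
    exact hci (PadicInt.ext ((algebraMap ℚ_[p] (PadicAlgCl p)).injective h3))
  · -- `g(c′ᵢ) = 0`
    change aeval (c'' i) g = 0
    rw [hg'Q]
    have h1 : algebraMap ℚ_[p] (PadicAlgCl p) (eval (c'' i) g') = 0 := by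
      rw [← aeval_algebraMap_apply_eq_algebraMap_eval, hc'']; exact (mem_aroots.1 (hφ _ (hcF i)).1).2
    exact (map_eq_zero_iff _ (algebraMap ℚ_[p] (PadicAlgCl p)).injective).1 h1
  · -- closeness
    change ‖c'' i - c i‖ < ρ
    exact (hclose'' i).trans_le (min_le_left _ _)

end Head

end Summit.HodgeConjecture.HodgeConjecture.R90.S3

end
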